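import Summits.QuantumFields.YangMills.Theses.BalabanLadder
import Summits.QuantumFields.YangMills.Theses.BalabanFamilyExport
import Summits.QuantumFields.YangMills.Theorems.BalabanLadderUVTorusClassDefs
import Summits.QuantumFields.YangMills.Theorems.BalabanLadderUVSeamRecStubTransport
import Summits.QuantumFields.YangMills.Theorems.BalabanLadderUVSeamRecUnitTransfer

/-!
# Line `family_export` on crux `UVSeamRec` (item stmt-QuantumFields-20043) — D-0145 ideator ym-idea-9, lens «complete»

The three stubs ARE the items of route `route-QuantumFields-BalabanFamilyExport` (born 2026-08-28T02:57Z, draft):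
`FamilyCeilings` (stmt-QuantumFields-25032), `FamilySeam` (25033), `FloorsEngine` (25034 = v5(α) `stub_floorsEngine` verbatim).
Shape (T) of E0PRIME-FIRST-LEMMA-20043-g5 / (B2) of STATE-OF-THE-CRUX-20043-g10, typed D-free: E0′ ceilings on Bałaban's own even
`L`-adic family tori `2·Lⁿ` (junction currency (c′) `MomentBounds6OnSides`) + the volume seam to odd tori, priced + the shared floors engine.
`UV` is idle by necessity (`Sect2Form` abstract; flat junk data inhabit the (B)-pins). No summit is proved by this line.
-/

namespace Summit.QuantumFields.YangMills.Cruxes.UVSeamRec.FamilyExport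

open Summit.QuantumFields.YangMills.Theses

/-- stub = route item `BalabanFamilyExport.FamilyCeilings` (stmt-QuantumFields-25032). -/
theorem stub_familyCeilings : BalabanFamilyExport.FamilyCeilings := by
  sorry

/-- stub = route item `BalabanFamilyExport.FamilySeam` (stmt-QuantumFields-25033). -/
theorem stub_familySeam : BalabanFamilyExport.FamilySeam := by
  sorry

/-- stub = route item `BalabanFamilyExport.FloorsEngine` (stmt-QuantumFields-25034; v5(α) `stub_floorsEngine` verbatim). -/
theorem stub_floorsEngine : BalabanFamilyExport.FloorsEngine := by
  sorry

/-- kernel-checked composition: the three stubs give the crux `UVSeamRec` BY NAME (= the route's `closes`). -/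
theorem UVSeamRec_of :
    BalabanFamilyExport.FamilyCeilings → BalabanFamilyExport.FamilySeam → BalabanFamilyExport.FloorsEngine →
      Summit.QuantumFields.YangMills.Theses.BalabanLadder.UVSeamRec :=
  fun h₁ h₂ h₃ => BalabanFamilyExport.closes h₁ h₂ h₃

/-- the crux from the stubs. -/
theorem UVSeamRec_holds_of_stubs : Summit.QuantumFields.YangMills.Theses.BalabanLadder.UVSeamRec :=
  UVSeamRec_of stub_familyCeilings stub_familySeam stub_floorsEngine

end Summit.QuantumFields.YangMills.Cruxes.UVSeamRec.FamilyExport
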